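import Literature.Probability.LatticeModels.CollarLegModelStrands
import Literature.Probability.LatticeModels.MedialCycleHopf

/-!
# Stub `stub_dictionaryPositivity` of line `rainbow-monomials-in-excursion-kernels` — D2 completion,
# sub-goal `s17_uncutLoopTurning`: an uncut cycle of the turning rule turns by `±4`
# (crux `BoundaryDefectGaussianR`, stmt-CriticalPhenomena-14132; insertion dictionary D2, layer 4)

The closed loops of the completed configuration `cfgOf ω` of a collar leg model that contain no cut
are cycles of minimal period of the turning rule `nextCorner (cfgOf ω)`; by the tree's Umlaufsatz for
cycles of the turning rule (`Literature.Probability.LatticeModels.medialCycle_turning_holds`, Hopf 1935)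
their total turning `∑ turnSign` is `±4`, so that each closed loop of the Baxter–Kelland–Wu strand
expansion carries the weight `e^{4iμ} + e^{-4iμ} = 2cos(π/3) = 1` (`μ = π/12`). This file is the
restatement of that theorem in the iterate form `(nextCorner β)^[m] c` used by the D2 completion
skeleton (registered sub-goal `s17_uncutLoopTurning` of stmt-CriticalPhenomena-14132).
-/

namespace Summit.CriticalPhenomena.CardyFormulaZ2.Cruxes.BoundaryDefectGaussianR.RainbowMonomialsInExcursionKernels

open Literature.Probability.LatticeModels

/-- The recursive corner orbit is the iterate of the turning rule. [folklore] -/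
theorem s17_cornerOrbit_eq_iterate (β : Literature.Probability.Percolation.BondConfig (Site 2))
    (c : Site 2 × Fin 4) (n : ℕ) : cornerOrbit β c n = (nextCorner β)^[n] c := by
  induction n with
  | zero => rfl
  | succ n ih => rw [Function.iterate_succ_apply', ← ih]; rfl

/-- **An uncut cycle of the turning rule turns by `±4`** (registered sub-goal `s17_uncutLoopTurning`):
for every collar leg model `M`, every set of live edges `ω`, and every corner `c` lying on a cycle of
minimal period `Q > 0` of the turning rule of the completed configuration `cfgOf ω`, the turning
numbers along the cycle add up to `4` or to `-4` — the tree's `medialCycle_turning_holds`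
(Hopf's Umlaufsatz for cycles of the turning rule) in iterate form. [cite: Hopf1935, Satz I] -/
theorem s17_uncutLoopTurning : ∀ (M : Literature.Probability.LatticeModels.CollarLegModel) (ω : Finset ((ℤ × ℤ) × Bool)) (c : Literature.Probability.LatticeModels.Site 2 × Fin 4) (Q : ℕ), 0 < Q → (Literature.Probability.LatticeModels.nextCorner (M.cfgOf ω))^[Q] c = c → (∀ s, 0 < s → s < Q → (Literature.Probability.LatticeModels.nextCorner (M.cfgOf ω))^[s] c ≠ c) → (∑ m ∈ Finset.range Q, Literature.Probability.LatticeModels.turnSign (M.cfgOf ω) ((Literature.Probability.LatticeModels.nextCorner (M.cfgOf ω))^[m] c) = 4 ∨ ∑ m ∈ Finset.range Q, Literature.Probability.LatticeModels.turnSign (M.cfgOf ω) ((Literature.Probability.LatticeModels.nextCorner (M.cfgOf ω))^[m] c) = -4) := by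
  intro M ω c Q hQ hcyc hmin
  have h := medialCycle_turning_holds (M.cfgOf ω) c Q hQ (by rw [s17_cornerOrbit_eq_iterate]; exact hcyc)
    (fun s hs hsQ => by rw [s17_cornerOrbit_eq_iterate]; exact hmin s hs hsQ)
  simpa only [s17_cornerOrbit_eq_iterate] using h

end Summit.CriticalPhenomena.CardyFormulaZ2.Cruxes.BoundaryDefectGaussianR.RainbowMonomialsInExcursionKernels
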